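import Literature.Algebra.EuclideanLattices.DiscreteGaussian
import Mathlib.Analysis.InnerProductSpace.Basic
import Mathlib.LinearAlgebra.Quotient.Basic
import HarnessLib

/-!
# Sublattices are positively correlated under the Gaussian measure (Regev–Stephens-Davidowitz 2017)

Topic `Algebra/EuclideanLattices`, a sequel of `DiscreteGaussian.lean` (`gaussianFunction s x =
e^{-π‖x‖²/s²}`, `gaussianMass s c A = ∑_{x ∈ A} ρ_s(x - c) ∈ [0, ∞]`). Everything in this file is
PROVED; there are no definitions and no named facts.

For a `ℤ`-submodule `L` of a real inner product space `E` write `ρ_{s,c}(L) = gaussianMass s c L`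
(the Gaussian mass of the coset `L - c`; Regev–Stephens-Davidowitz write `ρ_s(L + x)`, which is
`ρ_{s,-x}(L) = ρ_{s,x}(L)` by the symmetry `L = -L`). We prove, in this "mass" (cleared-denominator)
form and as (in)equalities in `ℝ≥0∞`:

* `gaussianMass_mul_gaussianMass_eq_tsum_classes` — **[RS17, Eq. (3)]**: with `t = s√2`,
  `ρ_{s,x}(L) ρ_{s,y}(L) = ∑_{q ∈ E/2L} h_q(x+y) h_q(x-y)`, `h_q(u) = ∑_{w ∈ L ∩ q} ρ_t(w - u)`;
* `gaussianMass_sq_mul_sq_le` — **[RS17, Thm. 2.1]** (the main inequality):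
  `ρ_{s,x}(L)² ρ_{s,y}(L)² ≤ ρ_s(L)² ρ_{s,x+y}(L) ρ_{s,x-y}(L)`;
* `two_mul_gaussianMass_mul_gaussianMass_le` — **[RS17, Cor. 2.2 (4c)]**:
  `2 ρ_{s,x}(L) ρ_{s,y}(L) ≤ ρ_s(L) (ρ_{s,x+y}(L) + ρ_{s,x-y}(L))`;
* `gaussianMass_sublattice_mul_le` — **[RS17, Prop. 4.3]** (the periodic Gaussian
  `f_L(x) = ρ_s(L + x)/ρ_s(L)` is monotone under sublattices): for `M ≤ L`,
  `ρ_{s,c}(M) ρ_s(L) ≤ ρ_s(M) ρ_{s,c}(L)`;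
* `gaussianMass_mul_gaussianMass_le_inf_mul` — **[RS17, Thm. 5.1]** (sublattices are positively
  correlated under the normalised Gaussian measure `D_{L,s}` on `L`; answers a question of Price):
  for `M, N ≤ L`, `ρ_s(M) ρ_s(N) ≤ ρ_s(M ∩ N) ρ_s(L)`, i.e.
  `Pr_{w ∼ D_{L,s}}[w ∈ M] · Pr[w ∈ N] ≤ Pr[w ∈ M ∩ N]`.

## Proofs

As printed in [RS17]. The identity Eq. (1)–(3) behind Thm. 2.1: by the "rotation identity"
`ρ_s(p)ρ_s(p') = ρ_{s√2}(p+p')ρ_{s√2}(p-p')` (`gaussianFunction_mul_eq`, the parallelogram law) and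
the substitution `(z₁, z₂) = (w + z, z)` on `L × L`,
`ρ_{s,x}(L) ρ_{s,y}(L) = ∑_{w ∈ L} ∑_{z ∈ L} ρ_t(w + 2z - (x+y)) ρ_t(w - (x-y))`
(`gaussianMass_mul_gaussianMass_eq_tsum`), and grouping `w` by its class modulo `2L` gives Eq. (3)
(`tsum_fibre_mul_fibre`; a class of `A` modulo `S` through `w₀` is `w₀ + (A ∩ S)`,
`tsum_fibre_mkQ_eq`). Thm. 2.1 is then Cauchy–Schwarz (`ennreal_tsum_mul_mul_self_le`, proved in
`ℝ≥0∞` from `2uv ≤ u² + v²` over pairs) together with `∑_q h_q(u)² = ρ_s(L) ρ_{s,u}(L)` (Eq. (3) at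
`y = 0`); (4c) is obtained from Eq. (3) and `2ab ≤ a² + b²` termwise (RS17 take `√(ab) ≤ (a+b)/2`
after Thm. 2.1; we avoid square roots in `ℝ≥0∞`). Prop. 4.3 and Thm. 5.1 are exactly as printed
(decompose `L`, resp. `M` and `L`, into classes modulo `M`, resp. `N`).

## Generality and conventions

* `E` is any real inner product space and `L, M, N` are arbitrary `ℤ`-submodules (no discreteness,
  rank or finite-index hypothesis): all sums are unconditional sums in `ℝ≥0∞`, classes are indexed
  by the quotient module `E ⧸ S` (classes not met by the lattice contribute `0`), and the only
  arithmetic input is that `E` has no `2`-torsion.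
* Any parameter `s : ℝ` is allowed (for `s = 0`, `ρ_0 ≡ 1` by the junk value of division and the
  inequalities hold trivially/by counting).

## References

* O. Regev, N. Stephens-Davidowitz, *An inequality for Gaussians on lattices*, SIAM J. Discrete
  Math. 31 (2017) 749–757, arXiv:1502.04796: Thm. 2.1 and its proof (Eq. (1)–(3)), Cor. 2.2 (4c),
  Prop. 4.3, Thm. 5.1. [RegevStephensdavidowitz2017]
* T. M. Price, *Inequality regarding sum of gaussian on lattices*, MathOverflow 160507 (2014) — the
  question answered by Thm. 5.1 (cited in [RS17, §5]).

What is NOT here: the normalised forms (4a), (4b) (divide by `ρ_s(L)⁴ ≠ 0, ∞` for a lattice and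
`s ≠ 0`, `gaussianMass_lattice_ne_zero/ne_top`), the dual forms (4d), (4e) (Poisson summation), the
moment and monotonicity-in-`s` results of §§3–4, and RS17's remark on other transformations `T`.
-/

noncomputable section

open scoped ENNReal
open Real

namespace Literature.Algebra.EuclideanLattices

variable {E : Type*} [NormedAddCommGroup E]

section Pointwise

variable [InnerProductSpace ℝ E]

/-! ### Pointwise identities -/

/-- The **rotation identity** of the Gaussian: `ρ_s(p) ρ_s(p') = ρ_{s√2}(p + p') ρ_{s√2}(p - p')`
(parallelogram law `‖p+p'‖² + ‖p-p'‖² = 2(‖p‖² + ‖p'‖²)`); Regev–Stephens-Davidowitz, §1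
("`ρ(x)²ρ(y)² = ρ(x+y)ρ(x-y)`", there with their normalisation) and Eq. (1).
[cite: RegevStephensdavidowitz2017, §1 and Eq. (1)] -/
theorem gaussianFunction_mul_eq (s : ℝ) (p p' : E) :
    gaussianFunction s p * gaussianFunction s p' =
      gaussianFunction (s * Real.sqrt 2) (p + p') *
        gaussianFunction (s * Real.sqrt 2) (p - p') := by
  simp only [gaussianFunction, ← Real.exp_add]
  congr 1
  have key : ‖p + p'‖ ^ 2 + ‖p - p'‖ ^ 2 = 2 * (‖p‖ ^ 2 + ‖p'‖ ^ 2) :=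
    parallelogram_law_with_norm ℝ p p'
  have h2 : (s * Real.sqrt 2) ^ 2 = s ^ 2 * 2 := by
    rw [mul_pow, Real.sq_sqrt (by norm_num : (0 : ℝ) ≤ 2)]
  rw [h2, ← add_div, ← add_div,
    show -π * ‖p + p'‖ ^ 2 + -π * ‖p - p'‖ ^ 2 = (-π * ‖p‖ ^ 2 + -π * ‖p'‖ ^ 2) * 2 by
      linear_combination (-π) * key,
    mul_div_mul_right _ _ (two_ne_zero)]

end Pointwise

/-- `2ab ≤ a² + b²` in `ℝ≥0∞` (write the larger as the smaller plus a difference). [folklore] -/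
private theorem ennreal_two_mul_mul_le_add_mul_self (a b : ℝ≥0∞) :
    2 * (a * b) ≤ a * a + b * b := by
  wlog hab : a ≤ b generalizing a b
  · calc 2 * (a * b) = 2 * (b * a) := by rw [mul_comm a b]
      _ ≤ b * b + a * a := this b a (le_of_not_ge hab)
      _ = a * a + b * b := add_comm _ _
  obtain ⟨d, rfl⟩ := exists_add_of_le hab
  calc 2 * (a * (a + d)) ≤ 2 * (a * (a + d)) + d * d := le_self_add
    _ = a * a + (a + d) * (a + d) := by ring

/-- Unfolding the Gaussian mass of a submodule as a sum over its elements. [folklore] -/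
private theorem gaussianMass_coe_submodule (L : Submodule ℤ E) (s : ℝ) (c : E) :
    gaussianMass s c (L : Set E) = ∑' x : L, ENNReal.ofReal (gaussianFunction s ((x : E) - c)) :=
  rfl

/-! ### Classes of a lattice modulo a submodule -/

/-- **The class of `w₀` in `A` modulo `S` is `w₀ + (A ∩ S)`.** For `ℤ`-submodules `A, S` of `E`, an
injective parametrisation `φ : ι → E` of `A ∩ S`, a point `w₀ ∈ A` with class `q ∈ E ⧸ S`, and any
`f : E → [0, ∞]`: `∑_{w ∈ A, w ≡ w₀ (S)} f(w) = ∑_i f(w₀ + φ i)` (the bijection `i ↦ w₀ + φ i`).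
[folklore] -/
private theorem tsum_fibre_mkQ_eq (A S : Submodule ℤ E) {ι : Type*} (φ : ι → E)
    (hφ : Function.Injective φ) (hAS : ∀ x : E, x ∈ A ∧ x ∈ S ↔ ∃ i, φ i = x) (f : E → ℝ≥0∞)
    {q : E ⧸ S} {w₀ : A} (hw₀ : (S.mkQ.comp A.subtype) w₀ = q) :
    ∑' w : (S.mkQ.comp A.subtype) ⁻¹' {q}, f w = ∑' i, f ((w₀ : E) + φ i) := by
  have hmemA : ∀ i, (w₀ : E) + φ i ∈ A := fun i => A.add_mem w₀.2 ((hAS _).2 ⟨i, rfl⟩).1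
  have hmemF : ∀ i, (⟨(w₀ : E) + φ i, hmemA i⟩ : A) ∈ (S.mkQ.comp A.subtype) ⁻¹' {q} := by
    intro i
    rw [Set.mem_preimage, Set.mem_singleton_iff, ← hw₀]
    simp only [LinearMap.coe_comp, Function.comp_apply, Submodule.coe_subtype, Submodule.mkQ_apply]
    rw [Submodule.Quotient.eq, add_sub_cancel_left]
    exact ((hAS _).2 ⟨i, rfl⟩).2
  let e : ι → (S.mkQ.comp A.subtype) ⁻¹' {q} := fun i => ⟨⟨(w₀ : E) + φ i, hmemA i⟩, hmemF i⟩
  have he : Function.Bijective e := by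
    constructor
    · intro i j h
      have h' : (w₀ : E) + φ i = w₀ + φ j :=
        congrArg (fun x : (S.mkQ.comp A.subtype) ⁻¹' {q} => ((x : A) : E)) h
      exact hφ (add_left_cancel h')
    · rintro ⟨w, hw⟩
      rw [Set.mem_preimage, Set.mem_singleton_iff, ← hw₀] at hw
      simp only [LinearMap.coe_comp, Function.comp_apply, Submodule.coe_subtype,
        Submodule.mkQ_apply] at hw
      rw [Submodule.Quotient.eq] at hw
      obtain ⟨i, hi⟩ := (hAS _).1 ⟨A.sub_mem w.2 w₀.2, hw⟩
      refine ⟨i, Subtype.ext (Subtype.ext ?_)⟩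
      show (w₀ : E) + φ i = w
      rw [hi, add_sub_cancel]
  rw [← (Equiv.ofBijective e he).tsum_eq]
  exact tsum_congr fun i => rfl

/-- **Product of two class sums, summed over the classes.** With `A, S, φ` as in
`tsum_fibre_mkQ_eq` and `f₁, f₂ : E → [0, ∞]`:
`∑_{q ∈ E/S} (∑_{w ∈ A ∩ q} f₁ w)(∑_{w ∈ A ∩ q} f₂ w) = ∑_{w ∈ A} ∑_i f₁(w + φ i) f₂(w)`
(Regev–Stephens-Davidowitz, Eq. (2)–(3): "we can view `ρ(L+x)ρ(L+y)` as the inner product of two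
vectors" indexed by the cosets).
[cite: RegevStephensdavidowitz2017, proof of Thm. 2.1, Eq. (2)–(3)] -/
theorem tsum_fibre_mul_fibre (A S : Submodule ℤ E) {ι : Type*} (φ : ι → E)
    (hφ : Function.Injective φ) (hAS : ∀ x : E, x ∈ A ∧ x ∈ S ↔ ∃ i, φ i = x)
    (f₁ f₂ : E → ℝ≥0∞) :
    ∑' q : E ⧸ S, (∑' w : (S.mkQ.comp A.subtype) ⁻¹' {q}, f₁ w) *
        (∑' w : (S.mkQ.comp A.subtype) ⁻¹' {q}, f₂ w) =
      ∑' w : A, ∑' i, f₁ ((w : E) + φ i) * f₂ w := by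
  calc ∑' q : E ⧸ S, (∑' w : (S.mkQ.comp A.subtype) ⁻¹' {q}, f₁ w) *
        (∑' w : (S.mkQ.comp A.subtype) ⁻¹' {q}, f₂ w)
      = ∑' q : E ⧸ S, ∑' w : (S.mkQ.comp A.subtype) ⁻¹' {q},
          (∑' w' : (S.mkQ.comp A.subtype) ⁻¹' {q}, f₁ w') * f₂ w := by
        refine tsum_congr fun q => ?_
        rw [ENNReal.tsum_mul_left]
    _ = ∑' q : E ⧸ S, ∑' w : (S.mkQ.comp A.subtype) ⁻¹' {q},
          (∑' w' : (S.mkQ.comp A.subtype) ⁻¹' {(S.mkQ.comp A.subtype) w}, f₁ w') * f₂ w := by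
        refine tsum_congr fun q => tsum_congr fun w => ?_
        rw [Set.mem_singleton_iff.mp (Set.mem_preimage.mp w.2)]
    _ = ∑' w : A, (∑' w' : (S.mkQ.comp A.subtype) ⁻¹' {(S.mkQ.comp A.subtype) w}, f₁ w') * f₂ w :=
        ENNReal.tsum_fiberwise
          (fun w : A => (∑' w' : (S.mkQ.comp A.subtype) ⁻¹' {(S.mkQ.comp A.subtype) w}, f₁ w') *
            f₂ w) (S.mkQ.comp A.subtype)
    _ = ∑' w : A, ∑' i, f₁ ((w : E) + φ i) * f₂ w := by
        refine tsum_congr fun w => ?_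
        rw [tsum_fibre_mkQ_eq A S φ hφ hAS f₁ rfl, ENNReal.tsum_mul_right]

/-! ### The main identity and Cor. 2.2 (4c) -/

section Inner

variable [InnerProductSpace ℝ E]

/-- **RS17 Eq. (1)–(2), sum form.** For a `ℤ`-submodule `L`, `t = s√2` and `x, y ∈ E`:
`ρ_{s,x}(L) ρ_{s,y}(L) = ∑_{w ∈ L} ∑_{z ∈ L} ρ_t(w + 2z - (x + y)) ρ_t(w - (x - y))`
(expand the product over `(z₁, z₂) ∈ L × L`, substitute `z₁ = w + z₂`, and apply the rotation
identity to `p = z₁ - x`, `p' = z₂ - y`).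
[cite: RegevStephensdavidowitz2017, proof of Thm. 2.1, Eq. (1)–(2)] -/
theorem gaussianMass_mul_gaussianMass_eq_tsum (L : Submodule ℤ E) (s : ℝ) (x y : E) :
    gaussianMass s x (L : Set E) * gaussianMass s y (L : Set E) =
      ∑' w : L, ∑' z : L,
        ENNReal.ofReal (gaussianFunction (s * Real.sqrt 2) ((w : E) + ((z : E) + z) - (x + y))) *
          ENNReal.ofReal (gaussianFunction (s * Real.sqrt 2) ((w : E) - (x - y))) := by
  rw [gaussianMass_coe_submodule, gaussianMass_coe_submodule]
  calc (∑' z₁ : L, ENNReal.ofReal (gaussianFunction s ((z₁ : E) - x))) *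
        ∑' z₂ : L, ENNReal.ofReal (gaussianFunction s ((z₂ : E) - y))
      = ∑' z₁ : L, ∑' z₂ : L, ENNReal.ofReal (gaussianFunction s ((z₁ : E) - x)) *
          ENNReal.ofReal (gaussianFunction s ((z₂ : E) - y)) := by
        rw [← ENNReal.tsum_mul_right]
        exact tsum_congr fun z₁ => ENNReal.tsum_mul_left.symm
    _ = ∑' z₂ : L, ∑' z₁ : L, ENNReal.ofReal (gaussianFunction s ((z₁ : E) - x)) *
          ENNReal.ofReal (gaussianFunction s ((z₂ : E) - y)) := ENNReal.tsum_comm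
    _ = ∑' z₂ : L, ∑' w : L, ENNReal.ofReal (gaussianFunction s (((w + z₂ : L) : E) - x)) *
          ENNReal.ofReal (gaussianFunction s ((z₂ : E) - y)) := by
        refine tsum_congr fun z₂ => ?_
        exact ((Equiv.addRight z₂).tsum_eq fun z₁ : L =>
          ENNReal.ofReal (gaussianFunction s ((z₁ : E) - x)) *
            ENNReal.ofReal (gaussianFunction s ((z₂ : E) - y))).symm
    _ = ∑' z : L, ∑' w : L,
        ENNReal.ofReal (gaussianFunction (s * Real.sqrt 2) ((w : E) + ((z : E) + z) - (x + y))) *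
          ENNReal.ofReal (gaussianFunction (s * Real.sqrt 2) ((w : E) - (x - y))) := by
        refine tsum_congr fun z => tsum_congr fun w => ?_
        have e1 : ((w + z : L) : E) - x + ((z : E) - y) = (w : E) + ((z : E) + z) - (x + y) := by
          push_cast; abel
        have e2 : ((w + z : L) : E) - x - ((z : E) - y) = (w : E) - (x - y) := by
          push_cast; abel
        rw [← ENNReal.ofReal_mul (gaussianFunction_pos _ _).le, gaussianFunction_mul_eq, e1, e2,
          ENNReal.ofReal_mul (gaussianFunction_pos _ _).le]
    _ = _ := ENNReal.tsum_comm

/-- **RS17 Eq. (3): `ρ(L+x)ρ(L+y)` is an inner product of two class-indexed vectors.** For a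
`ℤ`-submodule `L`, `t = s√2` and the classes `q ∈ E ⧸ 2L` (`2L = (id + id)(L)`):
`ρ_{s,x}(L) ρ_{s,y}(L) = ∑_q h_q(x + y) h_q(x - y)` with `h_q(u) = ∑_{w ∈ L ∩ q} ρ_t(w - u)`
(classes not met by `L` contribute `0`).
[cite: RegevStephensdavidowitz2017, proof of Thm. 2.1, Eq. (3)] -/
theorem gaussianMass_mul_gaussianMass_eq_tsum_classes (L : Submodule ℤ E) (s : ℝ) (x y : E) :
    gaussianMass s x (L : Set E) * gaussianMass s y (L : Set E) =
      ∑' q : E ⧸ L.map (LinearMap.id + LinearMap.id : E →ₗ[ℤ] E),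
        (∑' w : ((L.map (LinearMap.id + LinearMap.id : E →ₗ[ℤ] E)).mkQ.comp L.subtype) ⁻¹' {q},
            ENNReal.ofReal (gaussianFunction (s * Real.sqrt 2) ((w : E) - (x + y)))) *
          (∑' w : ((L.map (LinearMap.id + LinearMap.id : E →ₗ[ℤ] E)).mkQ.comp L.subtype) ⁻¹' {q},
            ENNReal.ofReal (gaussianFunction (s * Real.sqrt 2) ((w : E) - (x - y)))) := by
  -- the doubled lattice `2L ≤ L` and its parametrisation `z ↦ 2z` (`E` has no `2`-torsion)
  have hφ : Function.Injective (fun z : L => (z : E) + z) := by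
    intro z z' h
    have h2 : (2 : ℝ) • (z : E) = (2 : ℝ) • (z' : E) := by simpa only [two_smul] using h
    have h3 := congrArg (fun v : E => (2 : ℝ)⁻¹ • v) h2
    simp only [inv_smul_smul₀ (two_ne_zero' ℝ)] at h3
    exact Subtype.ext h3
  have hAS : ∀ v : E, v ∈ L ∧ v ∈ L.map (LinearMap.id + LinearMap.id : E →ₗ[ℤ] E) ↔
      ∃ z : L, (z : E) + z = v := by
    intro v
    constructor
    · rintro ⟨-, hv⟩
      obtain ⟨u, huL, hu⟩ := Submodule.mem_map.mp hv
      exact ⟨⟨u, huL⟩, by simpa using hu⟩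
    · rintro ⟨z, rfl⟩
      exact ⟨L.add_mem z.2 z.2, Submodule.mem_map.mpr ⟨z, z.2, by simp⟩⟩
  rw [gaussianMass_mul_gaussianMass_eq_tsum]
  exact (tsum_fibre_mul_fibre L _ (fun z : L => (z : E) + z) hφ hAS
    (fun e => ENNReal.ofReal (gaussianFunction (s * Real.sqrt 2) (e - (x + y))))
    (fun e => ENNReal.ofReal (gaussianFunction (s * Real.sqrt 2) (e - (x - y))))).symm

/-- **Cauchy–Schwarz for unconditional sums in `ℝ≥0∞`**: `(∑ aᵢbᵢ)² ≤ (∑ aᵢ²)(∑ bᵢ²)`, proved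
without subtraction from `2 (aᵢbⱼ)(aⱼbᵢ) ≤ (aᵢbⱼ)² + (aⱼbᵢ)²` summed over pairs. [folklore] -/
private theorem ennreal_tsum_mul_mul_self_le {ι : Type*} (a b : ι → ℝ≥0∞) :
    (∑' i, a i * b i) * (∑' i, a i * b i) ≤ (∑' i, a i * a i) * (∑' i, b i * b i) := by
  have hSS : (∑' i, a i * b i) * (∑' i, a i * b i) = ∑' i, ∑' j, (a i * b i) * (a j * b j) := by
    rw [← ENNReal.tsum_mul_right]
    exact tsum_congr fun i => ENNReal.tsum_mul_left.symm
  have hAB : (∑' i, a i * a i) * (∑' i, b i * b i) = ∑' i, ∑' j, (a i * a i) * (b j * b j) := by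
    rw [← ENNReal.tsum_mul_right]
    exact tsum_congr fun i => ENNReal.tsum_mul_left.symm
  have hcomm : ∑' j, ∑' i, (a i * a i) * (b j * b j) = ∑' i, ∑' j, (a i * a i) * (b j * b j) :=
    ENNReal.tsum_comm
  have key : 2 * ((∑' i, a i * b i) * (∑' i, a i * b i)) ≤
      2 * ((∑' i, a i * a i) * (∑' i, b i * b i)) := by
    calc 2 * ((∑' i, a i * b i) * (∑' i, a i * b i))
        = ∑' i, ∑' j, 2 * ((a i * b j) * (a j * b i)) := by
          rw [hSS, ← ENNReal.tsum_mul_left]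
          refine tsum_congr fun i => ?_
          rw [← ENNReal.tsum_mul_left]
          refine tsum_congr fun j => ?_
          ring
      _ ≤ ∑' i, ∑' j, ((a i * b j) * (a i * b j) + (a j * b i) * (a j * b i)) :=
          ENNReal.tsum_le_tsum fun i => ENNReal.tsum_le_tsum fun j =>
            ennreal_two_mul_mul_le_add_mul_self _ _
      _ = ∑' i, ∑' j, (a i * a i) * (b j * b j) + ∑' j, ∑' i, (a i * a i) * (b j * b j) := by
          rw [← ENNReal.tsum_add]
          refine tsum_congr fun i => ?_
          rw [← ENNReal.tsum_add]
          refine tsum_congr fun j => ?_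
          ring
      _ = 2 * ((∑' i, a i * a i) * (∑' i, b i * b i)) := by rw [hcomm, ← hAB, two_mul]
  exact (ENNReal.mul_le_mul_iff_right two_ne_zero ENNReal.ofNat_ne_top).mp key

/-- **RS17 Thm. 2.1 — the main inequality** (mass form): for every `ℤ`-submodule `L` of a real
inner product space, every `s` and all `x, y ∈ E`,
`ρ_{s,x}(L)² ρ_{s,y}(L)² ≤ ρ_{s,0}(L)² ρ_{s,x+y}(L) ρ_{s,x-y}(L)`, i.e.
`f_L(x)² f_L(y)² ≤ f_L(x+y) f_L(x-y)` for the periodic Gaussian `f_L = ρ_s(L + ·)/ρ_s(L)` ("a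
relaxation to the periodic case" of the rotation identity). Proof as printed: Eq. (3) and
Cauchy–Schwarz, with `‖h(u)‖² = ρ(L)ρ(L+u)` (Eq. (3) at `y = 0`).
[cite: RegevStephensdavidowitz2017, Thm. 2.1] -/
theorem gaussianMass_sq_mul_sq_le (L : Submodule ℤ E) (s : ℝ) (x y : E) :
    gaussianMass s x (L : Set E) ^ 2 * gaussianMass s y (L : Set E) ^ 2 ≤
      gaussianMass s 0 (L : Set E) ^ 2 *
        (gaussianMass s (x + y) (L : Set E) * gaussianMass s (x - y) (L : Set E)) := by
  -- `G u q` = the class sum `h_q(u)` of Eq. (3)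
  obtain ⟨G, hG⟩ : ∃ G : E → (E ⧸ L.map (LinearMap.id + LinearMap.id : E →ₗ[ℤ] E)) → ℝ≥0∞,
      ∀ u q, G u q = ∑' w : ((L.map (LinearMap.id + LinearMap.id : E →ₗ[ℤ] E)).mkQ.comp
        L.subtype) ⁻¹' {q}, ENNReal.ofReal (gaussianFunction (s * Real.sqrt 2) ((w : E) - u)) :=
    ⟨_, fun _ _ => rfl⟩
  have hA : ∀ x y : E, gaussianMass s x (L : Set E) * gaussianMass s y (L : Set E) =
      ∑' q, G (x + y) q * G (x - y) q := by
    intro x y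
    simp only [hG]
    exact gaussianMass_mul_gaussianMass_eq_tsum_classes L s x y
  have hA0 : ∀ u : E,
      ∑' q, G u q * G u q = gaussianMass s u (L : Set E) * gaussianMass s 0 (L : Set E) := by
    intro u
    have h := hA u 0
    rw [add_zero, sub_zero] at h
    exact h.symm
  calc gaussianMass s x (L : Set E) ^ 2 * gaussianMass s y (L : Set E) ^ 2
      = (∑' q, G (x + y) q * G (x - y) q) * (∑' q, G (x + y) q * G (x - y) q) := by
        rw [← hA]; ring
    _ ≤ (∑' q, G (x + y) q * G (x + y) q) * (∑' q, G (x - y) q * G (x - y) q) :=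
        ennreal_tsum_mul_mul_self_le _ _
    _ = gaussianMass s 0 (L : Set E) ^ 2 *
          (gaussianMass s (x + y) (L : Set E) * gaussianMass s (x - y) (L : Set E)) := by
        rw [hA0, hA0]; ring

/-- **RS17 Cor. 2.2, Eq. (4c)** (mass form): for every `ℤ`-submodule `L` of a real inner product
space, every `s` and all `x, y ∈ E`,
`2 ρ_{s,x}(L) ρ_{s,y}(L) ≤ ρ_{s,0}(L) (ρ_{s,x+y}(L) + ρ_{s,x-y}(L))`, i.e.
`f_L(x) f_L(y) ≤ (f_L(x+y) + f_L(x-y))/2`. RS17 derive it from Thm. 2.1 by `√(ab) ≤ (a+b)/2`; here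
directly from Eq. (3) and `2ab ≤ a² + b²` termwise (no square roots in `ℝ≥0∞`).
[cite: RegevStephensdavidowitz2017, Cor. 2.2 (4c)] -/
theorem two_mul_gaussianMass_mul_gaussianMass_le (L : Submodule ℤ E) (s : ℝ) (x y : E) :
    2 * gaussianMass s x (L : Set E) * gaussianMass s y (L : Set E) ≤
      gaussianMass s 0 (L : Set E) *
        (gaussianMass s (x + y) (L : Set E) + gaussianMass s (x - y) (L : Set E)) := by
  obtain ⟨G, hG⟩ : ∃ G : E → (E ⧸ L.map (LinearMap.id + LinearMap.id : E →ₗ[ℤ] E)) → ℝ≥0∞,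
      ∀ u q, G u q = ∑' w : ((L.map (LinearMap.id + LinearMap.id : E →ₗ[ℤ] E)).mkQ.comp
        L.subtype) ⁻¹' {q}, ENNReal.ofReal (gaussianFunction (s * Real.sqrt 2) ((w : E) - u)) :=
    ⟨_, fun _ _ => rfl⟩
  have hA : ∀ x y : E, gaussianMass s x (L : Set E) * gaussianMass s y (L : Set E) =
      ∑' q, G (x + y) q * G (x - y) q := by
    intro x y
    simp only [hG]
    exact gaussianMass_mul_gaussianMass_eq_tsum_classes L s x y
  have hA0 : ∀ u : E,
      ∑' q, G u q * G u q = gaussianMass s u (L : Set E) * gaussianMass s 0 (L : Set E) := by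
    intro u
    have h := hA u 0
    rw [add_zero, sub_zero] at h
    exact h.symm
  calc 2 * gaussianMass s x (L : Set E) * gaussianMass s y (L : Set E)
      = 2 * ∑' q, G (x + y) q * G (x - y) q := by rw [mul_assoc, hA]
    _ = ∑' q, 2 * (G (x + y) q * G (x - y) q) := ENNReal.tsum_mul_left.symm
    _ ≤ ∑' q, (G (x + y) q * G (x + y) q + G (x - y) q * G (x - y) q) :=
        ENNReal.tsum_le_tsum fun q => ennreal_two_mul_mul_le_add_mul_self _ _
    _ = gaussianMass s 0 (L : Set E) *
          (gaussianMass s (x + y) (L : Set E) + gaussianMass s (x - y) (L : Set E)) := by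
        rw [ENNReal.tsum_add, hA0, hA0]; ring

/-! ### Prop. 4.3 and Thm. 5.1 -/

/-- **RS17 Prop. 4.3** (mass form): for `ℤ`-submodules `M ≤ L` of a real inner product space,
every `s` and every centre `c`, `ρ_{s,c}(M) ρ_{s,0}(L) ≤ ρ_{s,0}(M) ρ_{s,c}(L)`, i.e. the periodic
Gaussian is monotone under sublattices, `f_M(c) ≤ f_L(c)`. Proof as printed: decompose `L` into
classes modulo `M`, apply (4c) on `M` to each class and its negative, and re-sum.
[cite: RegevStephensdavidowitz2017, Prop. 4.3] -/
theorem gaussianMass_sublattice_mul_le {L M : Submodule ℤ E} (hML : M ≤ L) (s : ℝ) (c : E) :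
    gaussianMass s c (M : Set E) * gaussianMass s 0 (L : Set E) ≤
      gaussianMass s 0 (M : Set E) * gaussianMass s c (L : Set E) := by
  -- class sums of `L` modulo `M`
  obtain ⟨Φ, hΦ⟩ : ∃ Φ : E → (E ⧸ M) → ℝ≥0∞, ∀ a q, Φ a q =
      ∑' w : (M.mkQ.comp L.subtype) ⁻¹' {q}, ENNReal.ofReal (gaussianFunction s ((w : E) - a)) :=
    ⟨_, fun _ _ => rfl⟩
  have hAS : ∀ v : E, v ∈ L ∧ v ∈ M ↔ ∃ m : M, (m : E) = v := fun v =>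
    ⟨fun h => ⟨⟨v, h.2⟩, rfl⟩, by rintro ⟨m, rfl⟩; exact ⟨hML m.2, m.2⟩⟩
  have hL : ∀ a : E, gaussianMass s a (L : Set E) = ∑' q, Φ a q := by
    intro a
    simp only [hΦ, gaussianMass_coe_submodule]
    exact (ENNReal.tsum_fiberwise
      (fun w : L => ENNReal.ofReal (gaussianFunction s ((w : E) - a))) (M.mkQ.comp L.subtype)).symm
  have hfib : ∀ (a : E) (w₀ : L),
      Φ a ((M.mkQ.comp L.subtype) w₀) = gaussianMass s (a - w₀) (M : Set E) := by
    intro a w₀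
    rw [hΦ, gaussianMass_coe_submodule]
    refine (tsum_fibre_mkQ_eq L M (fun m : M => (m : E)) Subtype.val_injective hAS
      (fun e => ENNReal.ofReal (gaussianFunction s (e - a))) rfl).trans ?_
    refine tsum_congr fun m => ?_
    rw [show (w₀ : E) + m - a = m - (a - w₀) by abel]
  -- the inequality class by class
  have hq : ∀ q : E ⧸ M, 2 * (gaussianMass s c (M : Set E) * Φ 0 q) ≤
      gaussianMass s 0 (M : Set E) * (Φ c q + Φ c (-q)) := by
    intro q
    rcases isEmpty_or_nonempty ((M.mkQ.comp L.subtype) ⁻¹' {q}) with hq | ⟨⟨w₀, hw₀⟩⟩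
    · have h0 : Φ 0 q = 0 := by rw [hΦ]; exact tsum_empty
      rw [h0, mul_zero, mul_zero]
      positivity
    · have hw₀' : (M.mkQ.comp L.subtype) w₀ = q :=
        Set.mem_singleton_iff.mp (Set.mem_preimage.mp hw₀)
      have hneg : (M.mkQ.comp L.subtype) (-w₀) = -q := by rw [map_neg, hw₀']
      have e0 : Φ 0 q = gaussianMass s (-(w₀ : E)) (M : Set E) := by rw [← hw₀', hfib, zero_sub]
      have e1 : Φ c q = gaussianMass s (c - w₀) (M : Set E) := by rw [← hw₀', hfib]
      have e2 : Φ c (-q) = gaussianMass s (c + w₀) (M : Set E) := by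
        rw [← hneg, hfib, Submodule.coe_neg, sub_neg_eq_add]
      rw [e0, e1, e2]
      have h := two_mul_gaussianMass_mul_gaussianMass_le M s c (-(w₀ : E))
      rw [← sub_eq_add_neg, sub_neg_eq_add, mul_assoc] at h
      exact h
  -- sum over the classes and cancel the factor `2`
  have hsum : 2 * (gaussianMass s c (M : Set E) * gaussianMass s 0 (L : Set E)) ≤
      2 * (gaussianMass s 0 (M : Set E) * gaussianMass s c (L : Set E)) := by
    have hn : ∑' q : E ⧸ M, Φ c (-q) = ∑' q, Φ c q := (Equiv.neg (E ⧸ M)).tsum_eq (Φ c)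
    calc 2 * (gaussianMass s c (M : Set E) * gaussianMass s 0 (L : Set E))
        = ∑' q, 2 * (gaussianMass s c (M : Set E) * Φ 0 q) := by
          rw [hL 0, ← ENNReal.tsum_mul_left, ← ENNReal.tsum_mul_left]
      _ ≤ ∑' q, gaussianMass s 0 (M : Set E) * (Φ c q + Φ c (-q)) := ENNReal.tsum_le_tsum hq
      _ = gaussianMass s 0 (M : Set E) * (∑' q, Φ c q + ∑' q, Φ c (-q)) := by
          rw [ENNReal.tsum_mul_left, ENNReal.tsum_add]
      _ = 2 * (gaussianMass s 0 (M : Set E) * gaussianMass s c (L : Set E)) := by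
          rw [hn, ← hL c]; ring
  exact (ENNReal.mul_le_mul_iff_right two_ne_zero ENNReal.ofNat_ne_top).mp hsum

/-- **RS17 Thm. 5.1 — sublattices are positively correlated under the Gaussian measure** (mass
form): for `ℤ`-submodules `M, N ≤ L` of a real inner product space and every `s`,
`ρ_s(M) ρ_s(N) ≤ ρ_s(M ∩ N) ρ_s(L)`; for a lattice `L` and `0 < s` this says
`Pr_{w ∼ D_{L,s}}[w ∈ M] · Pr_{w ∼ D_{L,s}}[w ∈ N] ≤ Pr_{w ∼ D_{L,s}}[w ∈ M ∩ N]` (Price's question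
was the case `N = L ∩ V`, `V` a subspace). Proof as printed: decompose `M` and `L` into classes
modulo `N`; a class of `M` through `w₀` has mass `ρ_{s,-w₀}(M ∩ N)`, the class of `L` through `w₀`
has mass `ρ_{s,-w₀}(N)`, and Prop. 4.3 for `M ∩ N ≤ N` compares them.
[cite: RegevStephensdavidowitz2017, Thm. 5.1] -/
theorem gaussianMass_mul_gaussianMass_le_inf_mul {L M N : Submodule ℤ E} (hML : M ≤ L)
    (hNL : N ≤ L) (s : ℝ) :
    gaussianMass s 0 (M : Set E) * gaussianMass s 0 (N : Set E) ≤
      gaussianMass s 0 ((M ⊓ N : Submodule ℤ E) : Set E) * gaussianMass s 0 (L : Set E) := by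
  -- class sums of `M` and of `L` modulo `N`
  obtain ⟨Ψ, hΨ⟩ : ∃ Ψ : (E ⧸ N) → ℝ≥0∞, ∀ q, Ψ q =
      ∑' w : (N.mkQ.comp M.subtype) ⁻¹' {q}, ENNReal.ofReal (gaussianFunction s ((w : E) - 0)) :=
    ⟨_, fun _ => rfl⟩
  obtain ⟨Θ, hΘ⟩ : ∃ Θ : (E ⧸ N) → ℝ≥0∞, ∀ q, Θ q =
      ∑' w : (N.mkQ.comp L.subtype) ⁻¹' {q}, ENNReal.ofReal (gaussianFunction s ((w : E) - 0)) :=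
    ⟨_, fun _ => rfl⟩
  have hMN : ∀ v : E, v ∈ M ∧ v ∈ N ↔ ∃ p : (M ⊓ N : Submodule ℤ E), (p : E) = v := fun v =>
    ⟨fun h => ⟨⟨v, Submodule.mem_inf.mpr h⟩, rfl⟩,
      by rintro ⟨p, rfl⟩; exact Submodule.mem_inf.mp p.2⟩
  have hLN : ∀ v : E, v ∈ L ∧ v ∈ N ↔ ∃ n : N, (n : E) = v := fun v =>
    ⟨fun h => ⟨⟨v, h.2⟩, rfl⟩, by rintro ⟨n, rfl⟩; exact ⟨hNL n.2, n.2⟩⟩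
  have hM : gaussianMass s 0 (M : Set E) = ∑' q, Ψ q := by
    simp only [hΨ, gaussianMass_coe_submodule]
    exact (ENNReal.tsum_fiberwise
      (fun w : M => ENNReal.ofReal (gaussianFunction s ((w : E) - 0))) (N.mkQ.comp M.subtype)).symm
  have hL : gaussianMass s 0 (L : Set E) = ∑' q, Θ q := by
    simp only [hΘ, gaussianMass_coe_submodule]
    exact (ENNReal.tsum_fiberwise
      (fun w : L => ENNReal.ofReal (gaussianFunction s ((w : E) - 0))) (N.mkQ.comp L.subtype)).symm
  -- class by class: Prop. 4.3 for `M ⊓ N ≤ N`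
  have hq : ∀ q : E ⧸ N, Ψ q * gaussianMass s 0 (N : Set E) ≤
      gaussianMass s 0 ((M ⊓ N : Submodule ℤ E) : Set E) * Θ q := by
    intro q
    rcases isEmpty_or_nonempty ((N.mkQ.comp M.subtype) ⁻¹' {q}) with hq | ⟨⟨w₀, hw₀⟩⟩
    · have h0 : Ψ q = 0 := by rw [hΨ]; exact tsum_empty
      rw [h0, zero_mul]
      positivity
    · have hw₀' : (N.mkQ.comp M.subtype) w₀ = q :=
        Set.mem_singleton_iff.mp (Set.mem_preimage.mp hw₀)
      have hw₀L : (N.mkQ.comp L.subtype) ⟨(w₀ : E), hML w₀.2⟩ = q := hw₀'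
      have eΨ : Ψ q = gaussianMass s (-(w₀ : E)) ((M ⊓ N : Submodule ℤ E) : Set E) := by
        rw [hΨ, ← hw₀', gaussianMass_coe_submodule]
        refine (tsum_fibre_mkQ_eq M N (fun p : (M ⊓ N : Submodule ℤ E) => (p : E))
          Subtype.val_injective hMN (fun e => ENNReal.ofReal (gaussianFunction s (e - 0)))
          rfl).trans ?_
        refine tsum_congr fun p => ?_
        rw [show (w₀ : E) + p - 0 = p - -(w₀ : E) by abel]
      have eΘ : Θ q = gaussianMass s (-(w₀ : E)) (N : Set E) := by
        rw [hΘ, ← hw₀L, gaussianMass_coe_submodule]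
        refine (tsum_fibre_mkQ_eq L N (fun n : N => (n : E)) Subtype.val_injective hLN
          (fun e => ENNReal.ofReal (gaussianFunction s (e - 0))) rfl).trans ?_
        refine tsum_congr fun n => ?_
        rw [show ((⟨(w₀ : E), hML w₀.2⟩ : L) : E) + n - 0 = n - -(w₀ : E) by
          rw [Submodule.coe_mk]; abel]
      rw [eΨ, eΘ]
      exact gaussianMass_sublattice_mul_le (inf_le_right : M ⊓ N ≤ N) s (-(w₀ : E))
  calc gaussianMass s 0 (M : Set E) * gaussianMass s 0 (N : Set E)
      = ∑' q, Ψ q * gaussianMass s 0 (N : Set E) := by rw [hM, ENNReal.tsum_mul_right]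
    _ ≤ ∑' q, gaussianMass s 0 ((M ⊓ N : Submodule ℤ E) : Set E) * Θ q := ENNReal.tsum_le_tsum hq
    _ = gaussianMass s 0 ((M ⊓ N : Submodule ℤ E) : Set E) * gaussianMass s 0 (L : Set E) := by
        rw [ENNReal.tsum_mul_left, ← hL]

end Inner

end Literature.Algebra.EuclideanLattices
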